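/-
Copyright (c) 2026 the pub-hodgecm-mathlib formalisation cell (harness21).  Prover seat hodgecm-mathlib-K2E3-p17 (g0),
Track B «K2-LIT» ∕ h413, unit U5Kazhdan of the line `K2_E3_EllipticInputs`, socket #17 `sig_K2E3PseudoCoeffExistsElliptic`
(`Cruxes/H413/Lines/K2_E3_EllipticInputsSigs_U5Kazhdan.lean` 87d8b4c974a167d7 :275–373): THE NOT-WILD HEAD.  2026-09-03.
-/
import Summits.HodgeConjecture.HodgeConjecture.Theorems.F0P3cStCharTSK1NotWildPseudoCoeff   -- ★ (T3) `exists_isPseudoCoeff_of_not_wild` (SS ∕ Kottwitz EP road, B1–B3)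
import Summits.HodgeConjecture.HodgeConjecture.Theorems.F0P3cStCharTSScPseudoCoeff          -- ★ (P) `exists_isPseudoCoeff_of_isSupercuspidal` (matrix-coefficient road)
import Summits.HodgeConjecture.HodgeConjecture.Theorems.F0P3cStCharTSEllOut                 -- ★ `isPseudoCoeff_zero_of_not_isEllipticRep`
import HarnessLib

/-!
# K2_E3 road (h413 = stmt-HodgeConjecture-24833), unit U5Kazhdan, socket #17 `sig_K2E3PseudoCoeffExistsElliptic` — THE NOT-WILD HEAD:
# at every non-split place `v` of `L⁺` that is unramified in `L` or prime to `2`, EVERY class of `U(Φ₃)(L⁺_v)` has a pseudo-coefficient at the §12.5 datum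

Cell `pub/hodgecm-mathlib` (D-0151), Track B (21-frontier RULING «PUSH BOTH» 2026-09-03), socket module
`Summits/HodgeConjecture/HodgeConjecture/Cruxes/H413/Lines/K2_E3_EllipticInputsSigs_U5Kazhdan.lean` (87d8b4c974a167d7), socket **`sig_K2E3PseudoCoeffExistsElliptic`**
(SIGS-TABLE-K2E3 row #17, XL): at the pinned datum `𝔇` of the organ `F0P3cStCharTSPaydown.stub_EllipticInputs`, EVERY non-split `v`, every elliptic class `π`
(★ `EllipticData.IsEllipticRep`) has `f_π ∈ C_c^∞(G)` with `Φ(γ, f_π) = 0` on `G^r − G^e` and `= \overline{χ_π(γ)}` on `G^e` (★ `EllipticData.IsPseudoCoeff`).  Print: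
«The existence of pseudo-coefficients follows from [K], Theorem 4.1.» [Rogawski1990, §12.6 p. 187].

THIS FILE pays the socket at every NOT-WILD place (`hv : v` unramified in `L ∨ |2|_v = 1`) — and there WITHOUT [K]: the tree holds two roads whose union is every
class, (P) the normalised matrix coefficient of a SUPERCUSPIDAL class is a pseudo-coefficient (★ `F0P3cStCharTSScPseudoCoeff.exists_isPseudoCoeff_of_isSupercuspidal`,
[HarishChandra1970] + the Selberg principle), and (T3) the Schneider–Stuhler ∕ Kottwitz Euler–Poincaré function on the Bruhat–Tits TREE of `U(Φ₃)(L⁺_v)` is a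
pseudo-coefficient of every NON-supercuspidal elliptic class (★ `F0P3cStCharTSK1NotWildPseudoCoeff.exists_isPseudoCoeff_of_not_wild`, unramified datum ∕ tame block
`σϖ = −ϖ`); a non-elliptic class has the zero pseudo-coefficient (★ `F0P3cStCharTSEllOut.isPseudoCoeff_zero_of_not_isEllipticRep`).  The binders of §1 are EXACTLY the
socket's place prefix `hns`, its Haar ∕ canonical-family binders `νQv mQv hcanQ` and its pins `hC01 hC04 hC05 hE hchar` (token for token), plus the guard `hv`.
* §1 **`exists_isPseudoCoeff_of_isEllipticRep_of_not_wild`** — the socket's conclusion `∀ π, 𝔇.IsEllipticRep π → ∃ f, 𝔇.IsPseudoCoeff π f` at a not-wild `v`;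
  **`exists_isPseudoCoeff_of_not_wild_all`** — the same for EVERY class (`IsEllipticRep` is idle).
* §2 **`exists_isPseudoCoeff_of_isEllipticRep_of_nonScHead`** — PLACE-FREE: at ANY non-split `v`, the socket's conclusion follows from the organ's T15-39 head
  shape `∀ π, 𝔇.IsEllipticRep π → ¬ π.IsSupercuspidal → ∃ f, 𝔇.IsPseudoCoeff π f` at `v` alone (the supercuspidal classes are served by ★ (P) at every place) —
  so the residue of #17 is exactly that head at a WILD `v`.
WHAT IS LEFT of #17 is the WILD place (`v ∣ 2` ramified in `L`): there the same Euler–Poincaré road needs the Bruhat–Tits tree of the WILD ramified `U(Φ₃)` (the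
junction of row #21 `sig_K2E3EPFunctionGWild`, OWNER Track A LH4 «(D-RAM) FOUR-FRAME»); [K] Thm. 4.1 is not needed at any place.

HONEST LABEL: HC_CM is proved only modulo the 7 printed citations (2 remaining named inputs: hLiu418 = stmt-HodgeConjecture-24832, h413 =
stmt-HodgeConjecture-24833) until rung 0 closes; this file is a `--supports stmt-HodgeConjecture-24833` helper (first rung of #17) and retires nothing by itself.

## References
* [Rogawski1990] J. D. Rogawski, *Automorphic Representations of Unitary Groups in Three Variables*, Ann. of Math. Stud. 123 (1990), §12.6 p. 187.
* [SchneiderStuhler1997] P. Schneider, U. Stuhler, *Representation theory and sheaves on the Bruhat–Tits building*, Publ. Math. IHÉS 85 (1997), Thm. III.4.16.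
* [Kottwitz1988] R. E. Kottwitz, *Tamagawa numbers*, Ann. of Math. 127 (1988), §2 Theorem 2.
* [HarishChandra1970] Harish-Chandra, *Harmonic analysis on reductive p-adic groups* (notes by G. van Dijk), LNM 162 (1970), Part I §1 Theorem 1.
-/

set_option autoImplicit false
-- the mandated namespace has the single-problem summit's repeated segment (`HodgeConjecture.HodgeConjecture`)
set_option linter.dupNamespace false

noncomputable section

open NumberField IsDedekindDomain MeasureTheory Filter Topology
open scoped Matrix MatrixGroups Valued
open Literature.NumberTheory.Rogawski1990 Literature.NumberTheory.Rogawski1990.Ch12Sec5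
open Literature.NumberTheory.Automorphic Literature.NumberTheory.Automorphic.UnitaryGroup

namespace Summit.HodgeConjecture.HodgeConjecture.Cruxes.H413.K2E3PseudoCoeffExistsEllipticNotWild

open Summit.HodgeConjecture.HodgeConjecture.Cruxes.H413
open Summit.HodgeConjecture.HodgeConjecture.Cruxes.H413.F0P3cStCharTSTorusDefs
open Summit.HodgeConjecture.HodgeConjecture.Cruxes.H413.F0P3cStCharTSK1NotWildPseudoCoeff (exists_isPseudoCoeff_of_not_wild)
open Summit.HodgeConjecture.HodgeConjecture.Cruxes.H413.F0P3cStCharTSScPseudoCoeff (exists_isPseudoCoeff_of_isSupercuspidal)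
open Summit.HodgeConjecture.HodgeConjecture.Cruxes.H413.F0P3cStCharTSEllOut (isPseudoCoeff_zero_of_not_isEllipticRep)

variable (L : Type) [Field L] [NumberField L] [IsCMField L] (v : HeightOneSpectrum (𝓞 ↥(maximalRealSubfield L)))

/-! ## §1  Every elliptic class has a pseudo-coefficient at a not-wild non-split place -/

set_option maxHeartbeats 1600000 in
-- statement-level instance-term unification on the CM local carriers (as ★ (T3) ∕ ★ (P), same binders)
/-- **#17 AT A NOT-WILD PLACE — every elliptic class of `U(Φ₃)(L⁺_v)` has a pseudo-coefficient at the §12.5 datum** (`v` non-split, `hv : v` unramified in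
`L ∨ |2|_v = 1`).  Print: «The existence of pseudo-coefficients follows from [K], Theorem 4.1» [Rogawski1990, §12.6 p. 187]; here WITHOUT [K]: a supercuspidal
class by the matrix-coefficient road ★ (P) `exists_isPseudoCoeff_of_isSupercuspidal`, a non-supercuspidal one by the Euler–Poincaré road ★ (T3)
`exists_isPseudoCoeff_of_not_wild` [SchneiderStuhler1997, Thm. III.4.16; Kottwitz1988, §2].  Binders = the socket's `hns`, `νQv mQv hcanQ`, `𝔇` and pins
`hC01 hC04 hC05 hE hchar` token for token, plus `hv`. [cite: Rogawski1990, §12.6 p. 187] [cite: SchneiderStuhler1997, Thm. III.4.16] [cite: Kottwitz1988, §2 Theorem 2]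
[cite: HarishChandra1970, Part I §1 Theorem 1] -/
theorem exists_isPseudoCoeff_of_isEllipticRep_of_not_wild
    (hns : ∀ w : PlacesOver L v, IsCMField.complexConj L • w.1 = w.1)
    (hv : Algebra.IsUnramifiedIn (𝓞 L) v.asIdeal ∨ Valued.v (2 : v.adicCompletion ↥(maximalRealSubfield L)) = 1)
    [MeasurableSpace (Gqs L v)] [BorelSpace (Gqs L v)]
    [∀ γ : Gqs L v, MeasurableSpace (Gqs L v ⧸ Subgroup.centralizer ({γ} : Set (Gqs L v)))]
    [∀ γ : Gqs L v, BorelSpace (Gqs L v ⧸ Subgroup.centralizer ({γ} : Set (Gqs L v)))]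
    [MeasurableSpace (Gqs L v ⧸ Subgroup.center (Gqs L v))]
    {H : Type} [Group H] [TopologicalSpace H] [IsTopologicalGroup H] [MeasurableSpace H]
    (νQv : Measure (Gqs L v)) [νQv.IsHaarMeasure] [νQv.IsMulRightInvariant] (mQv : OrbitalMeasureFamily (Gqs L v))
    (hcanQ : mQv.IsCanonical (fun γ => IsRegularElt (γ.val : GL (Fin 3) (UnitaryGroup.LocalRing L v))) νQv)
    (𝔇 : EllipticData (Gqs L v) H) (hC01 : 𝔇.μG = νQv) (hC04 : 𝔇.orb = mQv)
    (hC05 : ∀ γ : Gqs L v, γ ∈ 𝔇.regG ↔ IsRegularElt (γ.val : GL (Fin 3) (UnitaryGroup.LocalRing L v)))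
    (hE : ∀ γ : Gqs L v, γ ∈ 𝔇.ellG ↔ IsRegularElt (γ.val : GL (Fin 3) (UnitaryGroup.LocalRing L v)) ∧ γ ∉ hyperbolicSet L v)
    (hchar : ∀ π : IrrClass (Gqs L v), Measurable (𝔇.char π) ∧ LocallyIntegrable (𝔇.char π) 𝔇.μG ∧
      (∀ x ∈ 𝔇.regG, ∀ᶠ y in 𝓝 x, 𝔇.char π y = 𝔇.char π x) ∧
      ∀ φ : Gqs L v → ℂ, IsLocSmooth φ → π.smoothTrace 𝔇.μG φ = ∫ x, φ x * 𝔇.char π x ∂𝔇.μG) :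
    ∀ π : IrrClass (Gqs L v), 𝔇.IsEllipticRep π → ∃ f : Gqs L v → ℂ, 𝔇.IsPseudoCoeff π f := by
  intro π hπ
  by_cases hsc : π.IsSupercuspidal
  · obtain ⟨f, hf, -⟩ := exists_isPseudoCoeff_of_isSupercuspidal L v hns νQv mQv hcanQ 𝔇 hC01 hC04 hC05 hE hchar π hsc
    exact ⟨f, hf⟩
  · exact exists_isPseudoCoeff_of_not_wild L v hns hv νQv mQv hcanQ 𝔇 hC01 hC04 hC05 hE hchar π hπ hsc

set_option maxHeartbeats 1600000 in
-- statement-level instance-term unification on the CM local carriers (as §1's first theorem)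
/-- **EVERY class of `U(Φ₃)(L⁺_v)` has a pseudo-coefficient at a not-wild non-split place** — `IsEllipticRep` is idle: a non-elliptic class (`χ_π ≡ 0` on
`G^e`) has the ZERO pseudo-coefficient ★ `isPseudoCoeff_zero_of_not_isEllipticRep`; an elliptic one the first theorem of §1.  Same binders.
[cite: Rogawski1990, §12.6 p. 187] [cite: SchneiderStuhler1997, Thm. III.4.16] [cite: Kottwitz1988, §2 Theorem 2] -/
theorem exists_isPseudoCoeff_of_not_wild_all
    (hns : ∀ w : PlacesOver L v, IsCMField.complexConj L • w.1 = w.1)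
    (hv : Algebra.IsUnramifiedIn (𝓞 L) v.asIdeal ∨ Valued.v (2 : v.adicCompletion ↥(maximalRealSubfield L)) = 1)
    [MeasurableSpace (Gqs L v)] [BorelSpace (Gqs L v)]
    [∀ γ : Gqs L v, MeasurableSpace (Gqs L v ⧸ Subgroup.centralizer ({γ} : Set (Gqs L v)))]
    [∀ γ : Gqs L v, BorelSpace (Gqs L v ⧸ Subgroup.centralizer ({γ} : Set (Gqs L v)))]
    [MeasurableSpace (Gqs L v ⧸ Subgroup.center (Gqs L v))]
    {H : Type} [Group H] [TopologicalSpace H] [IsTopologicalGroup H] [MeasurableSpace H]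
    (νQv : Measure (Gqs L v)) [νQv.IsHaarMeasure] [νQv.IsMulRightInvariant] (mQv : OrbitalMeasureFamily (Gqs L v))
    (hcanQ : mQv.IsCanonical (fun γ => IsRegularElt (γ.val : GL (Fin 3) (UnitaryGroup.LocalRing L v))) νQv)
    (𝔇 : EllipticData (Gqs L v) H) (hC01 : 𝔇.μG = νQv) (hC04 : 𝔇.orb = mQv)
    (hC05 : ∀ γ : Gqs L v, γ ∈ 𝔇.regG ↔ IsRegularElt (γ.val : GL (Fin 3) (UnitaryGroup.LocalRing L v)))
    (hE : ∀ γ : Gqs L v, γ ∈ 𝔇.ellG ↔ IsRegularElt (γ.val : GL (Fin 3) (UnitaryGroup.LocalRing L v)) ∧ γ ∉ hyperbolicSet L v)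
    (hchar : ∀ π : IrrClass (Gqs L v), Measurable (𝔇.char π) ∧ LocallyIntegrable (𝔇.char π) 𝔇.μG ∧
      (∀ x ∈ 𝔇.regG, ∀ᶠ y in 𝓝 x, 𝔇.char π y = 𝔇.char π x) ∧
      ∀ φ : Gqs L v → ℂ, IsLocSmooth φ → π.smoothTrace 𝔇.μG φ = ∫ x, φ x * 𝔇.char π x ∂𝔇.μG) :
    ∀ π : IrrClass (Gqs L v), ∃ f : Gqs L v → ℂ, 𝔇.IsPseudoCoeff π f := by
  intro π
  by_cases hπ : 𝔇.IsEllipticRep π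
  · exact exists_isPseudoCoeff_of_isEllipticRep_of_not_wild L v hns hv νQv mQv hcanQ 𝔇 hC01 hC04 hC05 hE hchar π hπ
  · exact ⟨0, isPseudoCoeff_zero_of_not_isEllipticRep 𝔇 π hπ⟩

/-! ## §2  Place-free: the socket's conclusion from the non-supercuspidal head alone -/

set_option maxHeartbeats 1600000 in
-- statement-level instance-term unification on the CM local carriers (as §1)
/-- **#17 FROM THE NON-SUPERCUSPIDAL HEAD, AT ANY NON-SPLIT PLACE** (no `hv`): if every elliptic NON-supercuspidal class has a pseudo-coefficient at the datum
(the organ's T15-39 head shape at `v`, binder `hK1ns` — at a not-wild `v` this is ★ (T3); at a WILD `v` it is the Euler–Poincaré road over the wild Bruhat–Tits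
tree, row #21's junction), then EVERY elliptic class has one, the supercuspidal classes being served at every place by ★ (P)
`exists_isPseudoCoeff_of_isSupercuspidal` [HarishChandra1970, Part I §1 Thm. 1 + Selberg principle].  Binders = §1's without `hv`, plus `hK1ns`.
[cite: Rogawski1990, §12.6 p. 187] [cite: HarishChandra1970, Part I §1 Theorem 1] -/
theorem exists_isPseudoCoeff_of_isEllipticRep_of_nonScHead
    (hns : ∀ w : PlacesOver L v, IsCMField.complexConj L • w.1 = w.1)
    [MeasurableSpace (Gqs L v)] [BorelSpace (Gqs L v)]
    [∀ γ : Gqs L v, MeasurableSpace (Gqs L v ⧸ Subgroup.centralizer ({γ} : Set (Gqs L v)))]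
    [∀ γ : Gqs L v, BorelSpace (Gqs L v ⧸ Subgroup.centralizer ({γ} : Set (Gqs L v)))]
    [MeasurableSpace (Gqs L v ⧸ Subgroup.center (Gqs L v))]
    {H : Type} [Group H] [TopologicalSpace H] [IsTopologicalGroup H] [MeasurableSpace H]
    (νQv : Measure (Gqs L v)) [νQv.IsHaarMeasure] [νQv.IsMulRightInvariant] (mQv : OrbitalMeasureFamily (Gqs L v))
    (hcanQ : mQv.IsCanonical (fun γ => IsRegularElt (γ.val : GL (Fin 3) (UnitaryGroup.LocalRing L v))) νQv)
    (𝔇 : EllipticData (Gqs L v) H) (hC01 : 𝔇.μG = νQv) (hC04 : 𝔇.orb = mQv)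
    (hC05 : ∀ γ : Gqs L v, γ ∈ 𝔇.regG ↔ IsRegularElt (γ.val : GL (Fin 3) (UnitaryGroup.LocalRing L v)))
    (hE : ∀ γ : Gqs L v, γ ∈ 𝔇.ellG ↔ IsRegularElt (γ.val : GL (Fin 3) (UnitaryGroup.LocalRing L v)) ∧ γ ∉ hyperbolicSet L v)
    (hchar : ∀ π : IrrClass (Gqs L v), Measurable (𝔇.char π) ∧ LocallyIntegrable (𝔇.char π) 𝔇.μG ∧
      (∀ x ∈ 𝔇.regG, ∀ᶠ y in 𝓝 x, 𝔇.char π y = 𝔇.char π x) ∧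
      ∀ φ : Gqs L v → ℂ, IsLocSmooth φ → π.smoothTrace 𝔇.μG φ = ∫ x, φ x * 𝔇.char π x ∂𝔇.μG)
    (hK1ns : ∀ π : IrrClass (Gqs L v), 𝔇.IsEllipticRep π → ¬ π.IsSupercuspidal → ∃ f : Gqs L v → ℂ, 𝔇.IsPseudoCoeff π f) :
    ∀ π : IrrClass (Gqs L v), 𝔇.IsEllipticRep π → ∃ f : Gqs L v → ℂ, 𝔇.IsPseudoCoeff π f := by
  intro π hπ
  by_cases hsc : π.IsSupercuspidal
  · obtain ⟨f, hf, -⟩ := exists_isPseudoCoeff_of_isSupercuspidal L v hns νQv mQv hcanQ 𝔇 hC01 hC04 hC05 hE hchar π hsc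
    exact ⟨f, hf⟩
  · exact hK1ns π hπ hsc

end Summit.HodgeConjecture.HodgeConjecture.Cruxes.H413.K2E3PseudoCoeffExistsEllipticNotWild

end
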